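import Mathlib
import Summits.NavierStokesRegularity.NavierStokesRegularity.Theorems.SubOnsagerCeilingKPChainFirstPassageOvershoot
import HarnessLib

/-!
# First passages of the Katz–Pavlović chain BEGIN in a growth phase and END in exponential relaxation
(helper file under the crux `SubOnsagerCeiling.ForwardTailCeilingKP`, stmt-NavierStokesRegularity-27057, `--supports`;
companion of `Theorems/SubOnsagerCeilingKPChainFirstPassageOvershoot.lean`; MODEL lattice only)

The companion file bounds the overshoot of a shell `y` of the chain during a GROWTH PHASE (shell at or above its
Kolmogorov step `A`, successor below its step `A₁`, plateau bound `c_f x² ≤ c_d A A₁` on the shell behind). This file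
adds the two facts that make the growth phase the ONLY place where a first passage can happen and describe what
follows it, both from one integrating-factor comparison (`sub_le_exp_mul_of_deriv_le`):

* `relax_of_successorHigh` — while the successor is at or above its step (`z ≥ A₁ ≥ 0`) and the plateau bound holds,
  `y(t) − A ≤ e^{−c_d A₁ (t − t₀)} (y(t₀) − A)`: an overshoot relaxes toward the step at the rate `c_d A₁` (one
  Kolmogorov turnover of the successor), and
* `no_upward_crossing_of_successorHigh` — in particular a shell at or below its step stays there: the step can be
  crossed upward ONLY while the successor is below its own step, i.e. every first passage starts inside a growth phase
  of the companion file (`exists_successorLow_of_crossing`, the contrapositive packaging);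
* `kpChain_relax_of_successorHigh`, `kpChain_no_upward_crossing` — the chain itself, hypotheses in the format of the
  LEAD's rungs (`Theorems.VirtualFloor.GapRung.gap_chain10`, `Theorems.KPChainPeak.*`), steps `A`, `b^{-5/6}A`, plateau
  `Z_{k-1}² ≤ b^{5/3}A²`, rate `c₀ b^{5k/2} b^{-5/6} A`, uniformly in `b > 0`, `ν ≥ 0`, `c₀`, `k`.

READING (memo FIRST-PASSAGE-leafhand4-g15.md on the item): along the inviscid front the per-shell first-passage factor
`f(b)` (peak of shell `k` over the Kolmogorov step under the running maximum of shell `k-1`) is `≤ 1.027`, exceeds `1`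
only for `b ∈ (≈1.035, ≈1.3)`, and the chain corner of the stubs is `f(b) < b^{1/3}` (measured margins `0.8 %` at
`b = 1.05` … `6.5 %` at `1.25`); the lemmas here and in the companion are the qualitative episode structure (entry ⇒
growth phase ⇒ relaxation), not that `1 %`-level estimate. Nothing here closes a stub.
HONEST FRAMING: statements about MODEL lattice ODEs (route SubOnsagerCeiling, rung TL-M2Break); nothing here bears on
Navier–Stokes regularity and no crux or summit is proved.
[cite: BarbatoMorandinRomito2011, §2 Lemma 2.1 (invariant-region faces for the dyadic chain at one ratio)]
[cite: Tao2016AveragedNS, §4 (4.13) (the viscous model equation)]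
-/

noncomputable section

-- the sub-problem namespace `NavierStokesRegularity.NavierStokesRegularity` is the tree's layout (D-0017)
set_option linter.dupNamespace false

namespace Summit.NavierStokesRegularity.NavierStokesRegularity.Theorems.KPChainFirstPassage

open Set Real

/-! ## Integrating-factor comparison on a window -/

/-- **Linear relaxation bound.** If `u' ≤ −λ (u − L)` within `[t₀,t₁]` (derivative `u'` within the window at every
point), then `u(t) − L ≤ e^{−λ(t−t₀)} (u(t₀) − L)` on the window (the function `e^{λ(t−t₀)}(u(t) − L)` is
non-increasing). [folklore; Grönwall for a scalar linear inequality] -/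
theorem sub_le_exp_mul_of_deriv_le {u u' : ℝ → ℝ} {t₀ t₁ lam L : ℝ}
    (hu : ∀ t ∈ Icc t₀ t₁, HasDerivWithinAt u (u' t) (Icc t₀ t₁) t)
    (hineq : ∀ t ∈ Icc t₀ t₁, u' t ≤ -lam * (u t - L)) :
    ∀ t ∈ Icc t₀ t₁, u t - L ≤ exp (-(lam * (t - t₀))) * (u t₀ - L) := by
  -- `h τ := exp (lam (τ − t₀)) (u τ − L)` has non-positive derivative
  have hh : ∀ τ ∈ Icc t₀ t₁, HasDerivWithinAt (fun τ => exp (lam * (τ - t₀)) * (u τ - L))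
      (lam * exp (lam * (τ - t₀)) * (u τ - L) + exp (lam * (τ - t₀)) * u' τ) (Icc t₀ t₁) τ := by
    intro τ hτ
    have hlin : HasDerivWithinAt (fun τ => lam * (τ - t₀)) (lam * 1) (Icc t₀ t₁) τ :=
      ((hasDerivWithinAt_id τ _).sub_const t₀).const_mul lam
    have hexp : HasDerivWithinAt (fun τ => exp (lam * (τ - t₀))) (exp (lam * (τ - t₀)) * (lam * 1))
        (Icc t₀ t₁) τ := hlin.exp
    have hsub : HasDerivWithinAt (fun τ => u τ - L) (u' τ) (Icc t₀ t₁) τ := (hu τ hτ).sub_const L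
    have := hexp.mul hsub
    refine this.congr_deriv ?_
    ring
  have hneg : ∀ τ ∈ Icc t₀ t₁,
      lam * exp (lam * (τ - t₀)) * (u τ - L) + exp (lam * (τ - t₀)) * u' τ ≤ 0 := by
    intro τ hτ
    have he : 0 < exp (lam * (τ - t₀)) := exp_pos _
    have h1 : exp (lam * (τ - t₀)) * u' τ ≤ exp (lam * (τ - t₀)) * (-lam * (u τ - L)) :=
      mul_le_mul_of_nonneg_left (hineq τ hτ) he.le
    nlinarith
  intro t ht
  have hmono := le_of_derivWithin_nonpos hh hneg t ht
  simp only [sub_self, mul_zero, exp_zero, one_mul] at hmono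
  -- `exp(lam (t−t₀)) (u t − L) ≤ u t₀ − L`; multiply by `exp(−lam (t−t₀)) > 0`
  have he : 0 < exp (-(lam * (t - t₀))) := exp_pos _
  have := mul_le_mul_of_nonneg_left hmono he.le
  have hprod : exp (-(lam * (t - t₀))) * (exp (lam * (t - t₀)) * (u t - L)) = u t - L := by
    rw [← mul_assoc, ← Real.exp_add]; simp
  linarith [hprod]

/-! ## The abstract window: relaxation and no upward crossing while the successor is high -/

/-- **Relaxation while the successor is Kolmogorov-high.** On `[t₀,t₁]` let `ẏ = c_f x² − c_d y z − ν_y y` with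
`c_d, ν_y ≥ 0`, the plateau bound `c_f x² ≤ c_d A A₁`, `y ≥ 0`, and the successor at or above its step `z ≥ A₁`.
Then `y(t) − A ≤ e^{−c_d A₁ (t−t₀)} (y(t₀) − A)`: feed minus drain is at most `−c_d A₁ (y − A)`. [this file] -/
theorem relax_of_successorHigh {x y z : ℝ → ℝ} {t₀ t₁ cf cd νy A A₁ : ℝ}
    (hcd : 0 ≤ cd) (hνy : 0 ≤ νy)
    (hy : ∀ t ∈ Icc t₀ t₁, HasDerivWithinAt y (cf * x t ^ 2 - cd * (y t * z t) - νy * y t) (Icc t₀ t₁) t)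
    (hfeed : ∀ t ∈ Icc t₀ t₁, cf * x t ^ 2 ≤ cd * (A * A₁))
    (hy0 : ∀ t ∈ Icc t₀ t₁, 0 ≤ y t) (hzA : ∀ t ∈ Icc t₀ t₁, A₁ ≤ z t) :
    ∀ t ∈ Icc t₀ t₁, y t - A ≤ exp (-(cd * A₁ * (t - t₀))) * (y t₀ - A) := by
  refine sub_le_exp_mul_of_deriv_le hy ?_
  intro t ht
  have hyt := hy0 t ht
  have hzt := hzA t ht
  have h1 : cd * (y t * A₁) ≤ cd * (y t * z t) :=
    mul_le_mul_of_nonneg_left (mul_le_mul_of_nonneg_left hzt hyt) hcd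
  have h2 : 0 ≤ νy * y t := mul_nonneg hνy hyt
  have h3 := hfeed t ht
  nlinarith

/-- **No upward crossing of the step while the successor is high.** In the situation of `relax_of_successorHigh`,
if `y(t₀) ≤ A` then `y ≤ A` on the whole window. [this file] -/
theorem no_upward_crossing_of_successorHigh {x y z : ℝ → ℝ} {t₀ t₁ cf cd νy A A₁ : ℝ}
    (hcd : 0 ≤ cd) (hνy : 0 ≤ νy)
    (hy : ∀ t ∈ Icc t₀ t₁, HasDerivWithinAt y (cf * x t ^ 2 - cd * (y t * z t) - νy * y t) (Icc t₀ t₁) t)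
    (hfeed : ∀ t ∈ Icc t₀ t₁, cf * x t ^ 2 ≤ cd * (A * A₁))
    (hy0 : ∀ t ∈ Icc t₀ t₁, 0 ≤ y t) (hzA : ∀ t ∈ Icc t₀ t₁, A₁ ≤ z t) (hstart : y t₀ ≤ A) :
    ∀ t ∈ Icc t₀ t₁, y t ≤ A := by
  intro t ht
  have h := relax_of_successorHigh hcd hνy hy hfeed hy0 hzA t ht
  have he : 0 ≤ exp (-(cd * A₁ * (t - t₀))) := (exp_pos _).le
  have : exp (-(cd * A₁ * (t - t₀))) * (y t₀ - A) ≤ 0 :=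
    mul_nonpos_of_nonneg_of_nonpos he (by linarith)
  linarith

/-- **Every first passage starts in a growth phase (contrapositive packaging).** If the shell is at or below its
step at `t₀` and strictly above it at some `t ∈ [t₀,t₁]` (plateau bound, `y ≥ 0`, `c_d, ν_y ≥ 0` as above),
then at some time `τ ∈ [t₀,t]` the successor was strictly BELOW its step. [this file] -/
theorem exists_successorLow_of_crossing {x y z : ℝ → ℝ} {t₀ t₁ cf cd νy A A₁ : ℝ}
    (hcd : 0 ≤ cd) (hνy : 0 ≤ νy)
    (hy : ∀ t ∈ Icc t₀ t₁, HasDerivWithinAt y (cf * x t ^ 2 - cd * (y t * z t) - νy * y t) (Icc t₀ t₁) t)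
    (hfeed : ∀ t ∈ Icc t₀ t₁, cf * x t ^ 2 ≤ cd * (A * A₁))
    (hy0 : ∀ t ∈ Icc t₀ t₁, 0 ≤ y t) (hstart : y t₀ ≤ A)
    {t : ℝ} (ht : t ∈ Icc t₀ t₁) (hcross : A < y t) :
    ∃ τ ∈ Icc t₀ t, z τ < A₁ := by
  by_contra hcon
  push Not at hcon
  have hsub : Icc t₀ t ⊆ Icc t₀ t₁ := Icc_subset_Icc le_rfl ht.2
  have h := no_upward_crossing_of_successorHigh hcd hνy
    (fun τ hτ => (hy τ (hsub hτ)).mono hsub) (fun τ hτ => hfeed τ (hsub hτ)) (fun τ hτ => hy0 τ (hsub hτ))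
    hcon hstart t (right_mem_Icc.mpr ht.1)
  linarith

/-! ## The chain itself -/

/-- **Relaxation of a chain shell while its successor is Kolmogorov-high.** Let `Z` solve
`Ż_k = c₀ (b^{5(k-1)/2} Z_{k-1}² − b^{5k/2} Z_k Z_{k+1}) − ν b^{2k} Z_k` within `[0,s]` (`b > 0`, `c₀ ≥ 0`, `ν ≥ 0`), and
on a window `[t₀,t₁] ⊆ [0,s]`: `Z_{k-1}² ≤ b^{5/3} A²` (plateau), `Z_k ≥ 0`, `Z_{k+1} ≥ b^{-5/6} A` (successor at or above
its step). Then `Z_k(t) − A ≤ exp(−c₀ b^{5k/2} b^{-5/6} A (t − t₀)) (Z_k(t₀) − A)`. [this file] -/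
theorem kpChain_relax_of_successorHigh {b c₀ ν s A t₀ t₁ : ℝ} (hb : 0 < b) (hc₀ : 0 ≤ c₀) (hν : 0 ≤ ν)
    {Z : ℤ → ℝ → ℝ}
    (hode : ∀ k : ℕ, ∀ t ∈ Icc 0 s, HasDerivWithinAt (Z k)
      (c₀ * (b ^ ((5 : ℝ) * ((k : ℝ) - 1) / 2) * Z ((k : ℤ) - 1) t ^ 2 -
          b ^ ((5 : ℝ) * (k : ℝ) / 2) * (Z k t * Z ((k : ℤ) + 1) t)) -
        ν * b ^ ((2 : ℝ) * (k : ℝ)) * Z k t) (Icc 0 s) t)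
    {k : ℕ} (hwin : Icc t₀ t₁ ⊆ Icc 0 s)
    (hplat : ∀ t ∈ Icc t₀ t₁, Z ((k : ℤ) - 1) t ^ 2 ≤ b ^ ((5 : ℝ) / 3) * A ^ 2)
    (hZ0 : ∀ t ∈ Icc t₀ t₁, 0 ≤ Z k t)
    (hsuccA : ∀ t ∈ Icc t₀ t₁, b ^ (-(5 : ℝ) / 6) * A ≤ Z ((k : ℤ) + 1) t) :
    ∀ t ∈ Icc t₀ t₁, Z k t - A ≤
      exp (-(c₀ * b ^ ((5 : ℝ) * (k : ℝ) / 2) * (b ^ (-(5 : ℝ) / 6) * A) * (t - t₀))) * (Z k t₀ - A) := by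
  set cf : ℝ := c₀ * b ^ ((5 : ℝ) * ((k : ℝ) - 1) / 2) with hcf
  set cd : ℝ := c₀ * b ^ ((5 : ℝ) * (k : ℝ) / 2) with hcd
  set νy : ℝ := ν * b ^ ((2 : ℝ) * (k : ℝ)) with hνy
  set A₁ : ℝ := b ^ (-(5 : ℝ) / 6) * A with hA₁
  have hcd0 : 0 ≤ cd := by positivity
  have hνy0 : 0 ≤ νy := by positivity
  have hy : ∀ t ∈ Icc t₀ t₁, HasDerivWithinAt (Z k)
      (cf * Z ((k : ℤ) - 1) t ^ 2 - cd * (Z k t * Z ((k : ℤ) + 1) t) - νy * Z k t) (Icc t₀ t₁) t := by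
    intro t ht
    refine ((hode k t (hwin ht)).mono hwin).congr_deriv ?_
    rw [hcf, hcd, hνy]; ring
  have hpow1 : b ^ ((5 : ℝ) * ((k : ℝ) - 1) / 2) * b ^ ((5 : ℝ) / 3) =
      b ^ ((5 : ℝ) * (k : ℝ) / 2) * b ^ (-(5 : ℝ) / 6) := by
    rw [← Real.rpow_add hb, ← Real.rpow_add hb]; congr 1; ring
  have hfeed : ∀ t ∈ Icc t₀ t₁, cf * Z ((k : ℤ) - 1) t ^ 2 ≤ cd * (A * A₁) := by
    intro t ht
    have h1 : cf * Z ((k : ℤ) - 1) t ^ 2 ≤ cf * (b ^ ((5 : ℝ) / 3) * A ^ 2) :=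
      mul_le_mul_of_nonneg_left (hplat t ht) (by positivity)
    have h2 : cf * (b ^ ((5 : ℝ) / 3) * A ^ 2) = cd * (A * A₁) := by
      rw [hcf, hcd, hA₁]
      have : c₀ * b ^ ((5 : ℝ) * ((k : ℝ) - 1) / 2) * (b ^ ((5 : ℝ) / 3) * A ^ 2) =
          c₀ * (b ^ ((5 : ℝ) * ((k : ℝ) - 1) / 2) * b ^ ((5 : ℝ) / 3)) * A ^ 2 := by ring
      rw [this, hpow1]; ring
    linarith
  exact relax_of_successorHigh hcd0 hνy0 hy hfeed hZ0 hsuccA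

/-- **No upward crossing for the chain.** In the situation of `kpChain_relax_of_successorHigh`, if `Z_k(t₀) ≤ A` then
`Z_k ≤ A` on the window: a chain shell crosses the Kolmogorov step under its predecessor's plateau ONLY while its
successor is below its own step (where `kpChain_firstPassage_overshoot` of the companion file applies). [this file] -/
theorem kpChain_no_upward_crossing {b c₀ ν s A t₀ t₁ : ℝ} (hb : 0 < b) (hc₀ : 0 ≤ c₀) (hν : 0 ≤ ν)
    {Z : ℤ → ℝ → ℝ}
    (hode : ∀ k : ℕ, ∀ t ∈ Icc 0 s, HasDerivWithinAt (Z k)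
      (c₀ * (b ^ ((5 : ℝ) * ((k : ℝ) - 1) / 2) * Z ((k : ℤ) - 1) t ^ 2 -
          b ^ ((5 : ℝ) * (k : ℝ) / 2) * (Z k t * Z ((k : ℤ) + 1) t)) -
        ν * b ^ ((2 : ℝ) * (k : ℝ)) * Z k t) (Icc 0 s) t)
    {k : ℕ} (hwin : Icc t₀ t₁ ⊆ Icc 0 s)
    (hplat : ∀ t ∈ Icc t₀ t₁, Z ((k : ℤ) - 1) t ^ 2 ≤ b ^ ((5 : ℝ) / 3) * A ^ 2)
    (hZ0 : ∀ t ∈ Icc t₀ t₁, 0 ≤ Z k t)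
    (hsuccA : ∀ t ∈ Icc t₀ t₁, b ^ (-(5 : ℝ) / 6) * A ≤ Z ((k : ℤ) + 1) t) (hstart : Z k t₀ ≤ A) :
    ∀ t ∈ Icc t₀ t₁, Z k t ≤ A := by
  intro t ht
  have h := kpChain_relax_of_successorHigh hb hc₀ hν hode hwin hplat hZ0 hsuccA t ht
  have he : 0 ≤ exp (-(c₀ * b ^ ((5 : ℝ) * (k : ℝ) / 2) * (b ^ (-(5 : ℝ) / 6) * A) * (t - t₀))) :=
    (exp_pos _).le
  have : exp (-(c₀ * b ^ ((5 : ℝ) * (k : ℝ) / 2) * (b ^ (-(5 : ℝ) / 6) * A) * (t - t₀))) * (Z k t₀ - A) ≤ 0 :=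
    mul_nonpos_of_nonneg_of_nonpos he (by linarith)
  linarith

/-! ## From a per-passage factor to the exponent (the dictionary used by the calibration memo) -/

/-- **Barrier from a per-passage factor.** If the datum shell stays below `x₀` and every value of every shell
`k ≥ 1` on `[0,s]` is at most `f` times the Kolmogorov step `b^{-5/6} Z_{k-1}(t')` under SOME value of the shell behind
(e.g. under its running maximum — the first-passage factor of the memo), then `Z_k ≤ (f b^{-5/6})^k x₀` on `[0,s]`
for every `k`. [this file] -/
theorem barrier_of_passageFactor {b s x₀ f : ℝ} (hb : 0 < b) (hf : 0 ≤ f) {Z : ℤ → ℝ → ℝ}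
    (h0 : ∀ t ∈ Icc 0 s, Z 0 t ≤ x₀)
    (hpass : ∀ k : ℕ, 1 ≤ k → ∀ t ∈ Icc 0 s, ∃ t' ∈ Icc 0 s,
      Z k t ≤ f * b ^ (-(5 : ℝ) / 6) * Z ((k : ℤ) - 1) t') :
    ∀ k : ℕ, ∀ t ∈ Icc 0 s, Z k t ≤ (f * b ^ (-(5 : ℝ) / 6)) ^ k * x₀ := by
  have hq : 0 ≤ f * b ^ (-(5 : ℝ) / 6) := mul_nonneg hf (Real.rpow_nonneg hb.le _)
  intro k
  induction k with
  | zero => intro t ht; simpa using h0 t ht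
  | succ k ih =>
    intro t ht
    obtain ⟨t', ht', hle⟩ := hpass (k + 1) (by omega) t ht
    have hcast : (((k + 1 : ℕ) : ℤ) - 1) = (k : ℤ) := by push_cast; ring
    rw [hcast] at hle
    have h2 : f * b ^ (-(5 : ℝ) / 6) * Z (k : ℤ) t' ≤
        f * b ^ (-(5 : ℝ) / 6) * ((f * b ^ (-(5 : ℝ) / 6)) ^ k * x₀) :=
      mul_le_mul_of_nonneg_left (ih t' ht') hq
    calc Z ((k + 1 : ℕ) : ℤ) t ≤ f * b ^ (-(5 : ℝ) / 6) * Z (k : ℤ) t' := hle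
      _ ≤ f * b ^ (-(5 : ℝ) / 6) * ((f * b ^ (-(5 : ℝ) / 6)) ^ k * x₀) := h2
      _ = (f * b ^ (-(5 : ℝ) / 6)) ^ (k + 1) * x₀ := by ring

/-- **The factor as an exponent.** For `b > 0`, `b ≠ 1`, `f > 0`: `f · b^{-5/6} = b^{-(5/6 − log_b f)}`, so the barrier
of `barrier_of_passageFactor` is the `θ`-shell barrier with `θ = 5/6 − log_b f` (and constant one). [this file] -/
theorem passageFactor_eq_rpow {b f : ℝ} (hb : 0 < b) (hb1 : b ≠ 1) (hf : 0 < f) :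
    f * b ^ (-(5 : ℝ) / 6) = b ^ (-((5 : ℝ) / 6 - Real.logb b f)) := by
  have : f = b ^ Real.logb b f := (Real.rpow_logb hb hb1 hf).symm
  conv_lhs => rw [this]
  rw [← Real.rpow_add hb]
  congr 1; ring

/-- **The exponent form of the barrier.** Under the hypotheses of `barrier_of_passageFactor` with `f > 0`, `b ≠ 1`:
`Z_k(t) ≤ b^{-θ k} x₀` with `θ = 5/6 − log_b f`. [this file] -/
theorem rpow_barrier_of_passageFactor {b s x₀ f : ℝ} (hb : 0 < b) (hb1 : b ≠ 1) (hf : 0 < f) {Z : ℤ → ℝ → ℝ}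
    (h0 : ∀ t ∈ Icc 0 s, Z 0 t ≤ x₀)
    (hpass : ∀ k : ℕ, 1 ≤ k → ∀ t ∈ Icc 0 s, ∃ t' ∈ Icc 0 s,
      Z k t ≤ f * b ^ (-(5 : ℝ) / 6) * Z ((k : ℤ) - 1) t') :
    ∀ k : ℕ, ∀ t ∈ Icc 0 s, Z k t ≤ b ^ (-(((5 : ℝ) / 6 - Real.logb b f)) * (k : ℝ)) * x₀ := by
  intro k t ht
  have h := barrier_of_passageFactor hb hf.le h0 hpass k t ht
  rw [passageFactor_eq_rpow hb hb1 hf, ← Real.rpow_mul_natCast hb.le] at h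
  exact h

/-- **The chain corner in the factor currency.** For `b > 1` and `f > 0`: the exponent `θ = 5/6 − log_b f` is
sub-Onsager-admissible, `θ > 1/2`, iff `f < b^{1/3}` — the form in which the calibration memo states the open content
of the stubs (measured first-passage factors `f(b) ≤ 1.027`, margins to `b^{1/3}` of `0.8 %`–`6.5 %` on `b ∈ [1.05, 1.25]`).
[this file] -/
theorem theta_gt_half_iff_factor_lt {b f : ℝ} (hb : 1 < b) (hf : 0 < f) :
    (1 : ℝ) / 2 < 5 / 6 - Real.logb b f ↔ f < b ^ ((1 : ℝ) / 3) := by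
  rw [← Real.logb_lt_iff_lt_rpow hb hf]
  constructor <;> intro h <;> linarith

end Summit.NavierStokesRegularity.NavierStokesRegularity.Theorems.KPChainFirstPassage

end
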